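import Summits.CriticalPhenomena.PercolationContinuityZ3.Theorems.PercNearOneGluingNoHeavyLowerTailQuantitativeBHKPositiveStrict
import HarnessLib

/-!
# Multi-target strictness of BHK's Theorem 1.3 for connection events (one cluster hitting a SET of targets)

Support file (`--supports stmt-CriticalPhenomena-4575`), prover seat `prim-rate-mine-2` (lane prim-rate, constants-miner (c), BENCH rows
M2-R16 / M2-R33; `run/shared/lean/prim/prim-rate/prim-rate-mine-2/PROOFS.md` §P14, §P32, §P36).  No definitions, no named facts, no sorries;
standard axioms.

van den Berg–Häggström–Kahn's Theorem 1.3: given `D = {s ↮ X}` the cluster of `s` is positively associated.  Row M2-R16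
(`QuantBHK.condCov_openConn_pos`) made this STRICT for two connection events `{s ↔ a}`, `{s ↔ b}` under a path condition.  THIS FILE is the
multi-target version needed by the equality locus of the pattern transfer (row M2-R33 (Z), PROOFS §P32): for a target SET `B ∌ s`,

* `QuantBHK.condCov_openConn_multi_pos` — `μ(D ∩ {s↔a})·μ(D ∩ {s↔B}) < μ(D)·μ(D ∩ {s↔a} ∩ {s↔B})`, `{s↔B} = {∃ b ∈ B, s ↔ b}`, as soon as an
  `E`-neighbour `u` of `s` is joined to `a` and to SOME `b ∈ B` in the support graph with the vertices `{s} ∪ X` deleted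
  (weights `0 < w < 1` on the support `E`, `0` off `E`);
* `QuantBHK.reachable_avoiding_or_first_visit` — the first-visit decomposition of a walk at a vertex (graph lemma used by row M2-R33).

Proof: the Glauber floor `QuantBHK.condCov_ge_glauberTerm` (row M2-R8(a)) at `e = su`, evaluated at the configuration «the two paths open,
everything else closed».
[cite: VandenbergHaggstromKahn2005, Thm. 1.3 (p. 6)] [cite: Harris1960, Lemma 4.1 (p. 16)]
-/

noncomputable section

namespace Summit.CriticalPhenomena.PercolationContinuityZ3.Theorems

open MeasureTheory Set Literature.Probability.LatticeModels Literature.Probability.Percolation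
open scoped Classical
open Literature.Probability.Percolation.BHK2006 DecisionTree

namespace QuantBHK

universe v

variable {V : Type v} [Fintype V]

omit [Fintype V] in
/-- First visit of a vertex `v` along a walk: a walk of `(V, S)` from `x ≠ v` either avoids `v` (so it runs in any `S' ⊇ {f ∈ S : v ∉ f}`),
or it reaches, through pairs avoiding `v`, a vertex `u ≠ v` with `s(u, v) ∈ S`, after which `v` is joined to the endpoint in `(V, S)`. [folklore] -/
theorem reachable_avoiding_or_first_visit {S S' : Set (Sym2 V)} (v : V) (hS' : ∀ f ∈ S, v ∉ f → f ∈ S') :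
    ∀ {x y : V} (_ : (openGraph S).Walk x y), x ≠ v →
      (openGraph S').Reachable x y ∨
        ∃ u, (openGraph S').Reachable x u ∧ s(u, v) ∈ S ∧ u ≠ v ∧ (openGraph S).Reachable v y := by
  intro x y W
  induction W with
  | nil => exact fun _ => Or.inl (SimpleGraph.Reachable.refl _)
  | @cons x x₁ y hadj W' ih =>
    intro hxv
    have hadj' := hadj
    rw [openGraph_adj] at hadj'
    obtain ⟨hmem, hne⟩ := hadj'
    by_cases hx₁ : x₁ = v
    · subst hx₁
      exact Or.inr ⟨x, SimpleGraph.Reachable.refl _, hmem, hxv, ⟨W'⟩⟩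
    · have hstep : (openGraph S').Adj x x₁ := by
        rw [openGraph_adj]
        refine ⟨hS' _ hmem ?_, hne⟩
        intro hv
        rcases Sym2.mem_iff.1 hv with h | h
        · exact hxv h.symm
        · exact hx₁ h.symm
      rcases ih hx₁ with h | ⟨u, hu, hs, huv, hvy⟩
      · exact Or.inl (hstep.reachable.trans h)
      · exact Or.inr ⟨u, hstep.reachable.trans hu, hs, huv, hvy⟩

/-- **Multi-target strictness of BHK Thm 1.3 for connection events.**  Weights non-degenerate on their support `E`, `s ∉ X`, `a ∉ X ∪ {s}`,
`s ∉ B`, a pair `su ∈ E` and paths `u ⇝ a`, `u ⇝ b` for some `b ∈ B` in the support graph with the vertices `{s} ∪ X` deleted.  Then, with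
`D = {s ↮ X}` and `{s ↔ B} = {∃ b ∈ B, s ↔ b}`:
`μ(D ∩ {s↔a})·μ(D ∩ {s↔B}) < μ(D)·μ(D ∩ {s↔a} ∩ {s↔B})`, i.e. `P(s↔a, s↔B | s↮X) > P(s↔a | s↮X)·P(s↔B | s↮X)` — BHK's Theorem 1.3 is STRICT
for the increasing pair `1{a ∈ C_s}`, `1{C_s ∩ B ≠ ∅}`.  Proof: `condCov_ge_glauberTerm` at `e = su` plus an explicit positive-weight configuration
(the single-target case is `condCov_openConn_pos`). [cite: VandenbergHaggstromKahn2005, Thm. 1.3 (p. 6)] -/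
theorem condCov_openConn_multi_pos (w : Sym2 V → unitInterval) (E : Set (Sym2 V))
    (hE0 : ∀ f, f ∉ E → (w f : ℝ) = 0) (hE1 : ∀ f ∈ E, 0 < (w f : ℝ) ∧ (w f : ℝ) < 1)
    (s : V) (X : Set V) (hs : s ∉ X) (a u : V) (B : Set V) (ha : a ≠ s ∧ a ∉ X) (hsB : s ∉ B)
    (hsu : s(s, u) ∈ E)
    (hua : (openGraph {f | f ∈ E ∧ s ∉ f ∧ ∀ x ∈ X, x ∉ f}).Reachable u a)
    (b : V) (hb : b ∈ B) (hub : (openGraph {f | f ∈ E ∧ s ∉ f ∧ ∀ x ∈ X, x ∉ f}).Reachable u b) :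
    (prodBernoulli w).real ({ω : BondConfig V | ∀ x ∈ X, ¬ (openGraph ω).Reachable s x} ∩ openConn s a) *
        (prodBernoulli w).real ({ω : BondConfig V | ∀ x ∈ X, ¬ (openGraph ω).Reachable s x} ∩
          {ω : BondConfig V | ∃ b ∈ B, (openGraph ω).Reachable s b}) <
      (prodBernoulli w).real {ω : BondConfig V | ∀ x ∈ X, ¬ (openGraph ω).Reachable s x} *
        (prodBernoulli w).real ({ω : BondConfig V | ∀ x ∈ X, ¬ (openGraph ω).Reachable s x} ∩ openConn s a ∩
          {ω : BondConfig V | ∃ b ∈ B, (openGraph ω).Reachable s b}) := by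
  set μ := prodBernoulli w with hμ
  set w' : Sym2 V → ℝ := fun f => (w f : ℝ) with hw'
  have hw0 : ∀ f, 0 ≤ w' f := fun f => (w f).2.1
  have hw1 : ∀ f, w' f ≤ 1 := fun f => (w f).2.2
  have hw1' : ∀ f, 0 < 1 - w' f := by
    intro f
    by_cases hf : f ∈ E
    · have := (hE1 f hf).2; simp only [hw']; linarith
    · have := hE0 f hf; simp only [hw']; linarith
  set D : Set (BondConfig V) := {ω : BondConfig V | ∀ x ∈ X, ¬ (openGraph ω).Reachable s x} with hD
  set M : Set (BondConfig V) := {ω : BondConfig V | ∃ b ∈ B, (openGraph ω).Reachable s b} with hM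
  have hmeas : ∀ S : Set (BondConfig V), MeasurableSet S := fun _ => MeasurableSet.of_discrete
  set Γ' : Set (Sym2 V) := {f | f ∈ E ∧ s ∉ f ∧ ∀ x ∈ X, x ∉ f} with hΓ'
  have hΓ's : ∀ f ∈ Γ', s ∉ f := fun f hf => hf.2.1
  have hΓ'X : ∀ x ∈ X, ∀ f ∈ Γ', x ∉ f := fun x hx f hf => hf.2.2 x hx
  -- the witnessing paths and the configuration `ζ`
  obtain ⟨p1⟩ := hua
  obtain ⟨p2⟩ := hub
  have hus : u ≠ s := fun h => ha.1 (eq_of_reachable_of_forall_notMem hΓ's (h ▸ (⟨p1⟩ : (openGraph Γ').Reachable u a)))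
  have huX : u ∉ X := fun huX =>
    ha.2 ((eq_of_reachable_of_forall_notMem (hΓ'X u huX) (⟨p1⟩ : (openGraph Γ').Reachable u a)).symm ▸ huX)
  set ζ : Set (Sym2 V) := {f | f ∈ p1.edges ∨ f ∈ p2.edges} with hζ
  have hζΓ : ∀ f ∈ ζ, f ∈ Γ' := by
    intro f hf
    rcases hf with hf | hf
    · exact (mem_and_not_isDiag_of_mem_edges p1 hf).1
    · exact (mem_and_not_isDiag_of_mem_edges p2 hf).1
  set e : Sym2 V := s(s, u) with he
  have heζ : e ∉ ζ := fun h => (hζΓ e h).2.1 (Sym2.mem_mk_left s u)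
  have hζe : ζ \ {e} = ζ := Set.sdiff_singleton_eq_self heζ
  have heE : e ∈ E := hsu
  -- (i) opening `e` at `ζ` keeps `s ↮ X`
  have hins_X : ∀ x ∈ X, ∀ f ∈ insert e ζ, x ∉ f := by
    intro x hx f hf
    rcases Set.mem_insert_iff.1 hf with hf | hf
    · rw [hf, he, Sym2.mem_iff]
      rintro (h | h)
      · exact hs (h ▸ hx)
      · exact huX (h ▸ hx)
    · exact hΓ'X x hx f (hζΓ f hf)
  have hζD : insert e ζ ∈ D := fun x hx h =>
    hs ((eq_of_reachable_of_forall_notMem (hins_X x hx) h.symm) ▸ hx)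
  -- (ii) after opening `e`, `a` and `b` join `C_s`; (iii) before, `C_s = {s}`
  have hadj : (openGraph (insert e ζ)).Adj s u := by
    rw [openGraph, SimpleGraph.fromEdgeSet_adj]
    exact ⟨Set.mem_insert _ _, hus.symm⟩
  have hsa : a ∈ openCluster (insert e ζ) s :=
    hadj.reachable.trans (reachable_of_walk_edges_subset p1 fun f hf => Set.mem_insert_of_mem _ (Or.inl hf))
  have hsb : b ∈ openCluster (insert e ζ) s :=
    hadj.reachable.trans (reachable_of_walk_edges_subset p2 fun f hf => Set.mem_insert_of_mem _ (Or.inr hf))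
  have hsB' : ∃ b ∈ B, b ∈ openCluster (insert e ζ) s := ⟨b, hb, hsb⟩
  have hζs : ∀ f ∈ ζ \ {e}, s ∉ f := fun f hf => hΓ's f (hζΓ f (by rw [hζe] at hf; exact hf))
  have hna : a ∉ openCluster (ζ \ {e}) s := fun h => ha.1 (eq_of_reachable_of_forall_notMem hζs h)
  have hnB : ¬ ∃ b ∈ B, b ∈ openCluster (ζ \ {e}) s := by
    rintro ⟨b', hb', h⟩
    exact hsB ((eq_of_reachable_of_forall_notMem hζs h) ▸ hb')
  -- the Glauber integrand, its sign, and its value at `ζ`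
  set F : Set V → ℝ := fun W => if a ∈ W then 1 else 0 with hF
  set G : Set V → ℝ := fun W => if (∃ b ∈ B, b ∈ W) then 1 else 0 with hG
  have hFmono : Monotone F := by
    intro W W' h
    simp only [hF]
    by_cases hc : a ∈ W
    · rw [if_pos hc, if_pos (h hc)]
    · rw [if_neg hc]; split_ifs <;> norm_num
  have hGmono : Monotone G := by
    intro W W' h
    simp only [hG]
    by_cases hc : ∃ b ∈ B, b ∈ W
    · have hc' : ∃ b ∈ B, b ∈ W' := hc.imp fun b hb => ⟨hb.1, h hb.2⟩
      rw [if_pos hc, if_pos hc']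
    · rw [if_neg hc]; split_ifs <;> norm_num
  set I : BondConfig V → ℝ := fun ω => D.indicator (fun _ => (1 : ℝ)) (insert e ω) *
    ((F (openCluster (insert e ω) s) - F (openCluster (ω \ {e}) s)) *
      (G (openCluster (insert e ω) s) - G (openCluster (ω \ {e}) s))) with hI
  have hmono_cl : ∀ ω : BondConfig V, openCluster (ω \ {e}) s ⊆ openCluster (insert e ω) s :=
    fun ω => openCluster_mono (Set.sdiff_subset.trans (Set.subset_insert e ω)) s
  have hI0 : ∀ ω, 0 ≤ I ω := fun ω =>
    mul_nonneg (Set.indicator_nonneg (fun _ _ => zero_le_one) _)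
      (mul_nonneg (sub_nonneg.2 (hFmono (hmono_cl ω))) (sub_nonneg.2 (hGmono (hmono_cl ω))))
  have hIζ : I ζ = 1 := by
    simp only [hI]
    rw [Set.indicator_of_mem hζD]
    simp only [hF, hG, if_pos hsa, if_neg hna, if_pos hsB', if_neg hnB]
    ring
  have hwζ : 0 < weight w' ζ := by
    refine Finset.prod_pos fun f _ => ?_
    split_ifs with hf
    · exact (hE1 f (hζΓ f hf).1).1
    · exact hw1' f
  have hint_pos : 0 < ∫ ω, I ω ∂μ := by
    rw [integral_prodBernoulli_eq_sum]
    have h1 : weight w' ζ * I ζ ≤ ∑ ω, weight w' ω * I ω :=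
      Finset.single_le_sum (fun ω _ => mul_nonneg (weight_nonneg hw0 hw1 ω) (hI0 ω)) (Finset.mem_univ ζ)
    have h2 : 0 < weight w' ζ * I ζ := by rw [hIζ, mul_one]; exact hwζ
    linarith
  have hD0 : 0 < μ.real D := by
    have h1 : μ.real {ω : BondConfig V | ∀ i ∈ (Finset.univ : Finset (Sym2 V)), i ∉ ω} ≤ μ.real D := by
      refine measureReal_mono fun ω hω x hx h => hs ?_
      exact (eq_of_reachable_of_forall_notMem (fun f hf _ => hω f (Finset.mem_univ f) hf) h) ▸ hx
    rw [prodBernoulli_real_forall_notMem] at h1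
    have h2 : 0 < ∏ i ∈ (Finset.univ : Finset (Sym2 V)), (1 - (w i : ℝ)) := Finset.prod_pos fun f _ => hw1' f
    linarith
  have hwe : 0 < (w e : ℝ) * (1 - w e) := mul_pos (hE1 e heE).1 (hw1' e)
  -- the kernel floor, with its integrals identified
  have key := condCov_ge_glauberTerm w s X e F G hFmono hGmono
  rw [← hμ, ← hD] at key
  have hind : (fun ω : BondConfig V => if a ∈ openCluster ω s then (1 : ℝ) else 0) =
      (openConn s a).indicator fun _ => (1 : ℝ) := by
    funext ω; simp only [Set.indicator_apply]; rfl
  have hindM : (fun ω : BondConfig V => if (∃ b ∈ B, b ∈ openCluster ω s) then (1 : ℝ) else 0) =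
      M.indicator fun _ => (1 : ℝ) := by
    funext ω
    by_cases h : ∃ b ∈ B, b ∈ openCluster ω s
    · rw [if_pos h, Set.indicator_of_mem (show ω ∈ M from h)]
    · rw [if_neg h, Set.indicator_of_notMem (show ω ∉ M from h)]
  have h1 : ∫ ω in D, F (openCluster ω s) ∂μ = μ.real (D ∩ openConn s a) := by
    simp only [hF]
    rw [hind, integral_indicator (hmeas _), Measure.restrict_restrict (hmeas _), integral_const, smul_eq_mul, mul_one,
      measureReal_restrict_apply_univ, Set.inter_comm]
  have h2 : ∫ ω in D, G (openCluster ω s) ∂μ = μ.real (D ∩ M) := by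
    simp only [hG]
    rw [hindM, integral_indicator (hmeas _), Measure.restrict_restrict (hmeas _), integral_const, smul_eq_mul, mul_one,
      measureReal_restrict_apply_univ, Set.inter_comm]
  have h3 : ∫ ω in D, F (openCluster ω s) * G (openCluster ω s) ∂μ = μ.real (D ∩ openConn s a ∩ M) := by
    have hFG : (fun ω : BondConfig V => F (openCluster ω s) * G (openCluster ω s)) =
        (openConn s a ∩ M).indicator fun _ => (1 : ℝ) := by
      funext ω
      by_cases h1 : a ∈ openCluster ω s
      · by_cases h2 : ∃ b ∈ B, b ∈ openCluster ω s
        · rw [Set.indicator_of_mem (show ω ∈ openConn s a ∩ M from ⟨h1, h2⟩)]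
          simp only [hF, hG, if_pos h1, if_pos h2, mul_one]
        · rw [Set.indicator_of_notMem (show ω ∉ openConn s a ∩ M from fun h => h2 h.2)]
          simp only [hF, hG, if_neg h2, mul_zero]
      · rw [Set.indicator_of_notMem (show ω ∉ openConn s a ∩ M from fun h => h1 h.1)]
        simp only [hF, hG, if_neg h1, zero_mul]
    rw [hFG, integral_indicator (hmeas _), Measure.restrict_restrict (hmeas _), integral_const, smul_eq_mul, mul_one,
      measureReal_restrict_apply_univ, Set.inter_comm, Set.inter_assoc]
  rw [h1, h2, h3] at key
  have hlhs : 0 < μ.real D * ((w e : ℝ) * (1 - w e) * ∫ ω, I ω ∂μ) := mul_pos hD0 (mul_pos hwe hint_pos)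
  have key' : μ.real D * ((w e : ℝ) * (1 - w e) * ∫ ω, I ω ∂μ) ≤
      μ.real D * μ.real (D ∩ openConn s a ∩ M) - μ.real (D ∩ openConn s a) * μ.real (D ∩ M) := key
  linarith

end QuantBHK

end Summit.CriticalPhenomena.PercolationContinuityZ3.Theorems

end
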